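import Summits.AtomisticToContinuum.BoseEinsteinCondensation.Theses.BECHusimiAmplitudeGas

/-!
# AtomisticToContinuum / BoseEinsteinCondensation — route `BECHusimiAmplitudeGas`, assembly

Settles the assembly item `stmt-AtomisticToContinuum-11999` of route
`route-AtomisticToContinuum-BECHusimiAmplitudeGas`: the implication
`PhaseCapDecay → AmplitudeLDP → TiltStability → BoundaryTransferWeak → FastFractionBound →
LaplaceCapUnion → RatioToCondensate → PositivityReduction → BoseEinsteinCondensation`
(the audited sub-problem abbrev `_root_.BoseEinsteinCondensation`, by name).

The hypotheses of `Assembly` are, verbatim and in the same order, those of the route's deciding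
theorem `closes`, so the assembly is that theorem curried; the composition is spelled out again
below for the record: the glue `LaplaceCapUnion` turns the two Husimi cruxes `PhaseCapDecay`,
`AmplitudeLDP` into `HusimiConcentration`; the glue `RatioToCondensate` combines it with
`TiltStability` and `FastFractionBound` into constant-mode BEC for nonnegative periodic
near-minimisers (`PeriodicBECNonneg`); `PositivityReduction` removes the sign condition, giving
the periodic-BEC body for every admissible potential `v`; and `BoundaryTransferWeak v hv` carries
that body to the Dirichlet criterion `∃ ρ₀ > 0, ∀ ρ ∈ (0, ρ₀), HasGroundStateBEC v ρ`, which is the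
conjunct `BoseEinsteinCondensation` at `v`. Pure logic; no analytic content lives here.

References: [LSSY2005, §1.2 and Ch. 5] (the conjunct being assembled).
-/

namespace Summit.AtomisticToContinuum.BoseEinsteinCondensation.Theorems

/-- Settles `stmt-AtomisticToContinuum-11999` (exact signature): the assembly of route
`BECHusimiAmplitudeGas`, i.e. its eight items imply the sub-problem statement
`BoseEinsteinCondensation`. Proof: for each admissible `v`, `BoundaryTransferWeak v hv` applied to
the periodic-BEC body produced by `PositivityReduction` from
`RatioToCondensate (LaplaceCapUnion PhaseCapDecay AmplitudeLDP) TiltStability FastFractionBound`.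
Pure composition of the route's hypotheses (the route's deciding theorem `closes`, curried).
[folklore] -/
theorem becHusimiAmplitudeGas_assembly_proof :
    Summit.AtomisticToContinuum.BoseEinsteinCondensation.Theses.BECHusimiAmplitudeGas.Assembly := by
  unfold Theses.BECHusimiAmplitudeGas.Assembly
  intro h₁ h₂ h₃ h₄ h₅ h₆ h₇ h₈ v hv
  exact h₄ v hv (h₈ (h₇ (h₆ h₁ h₂) h₃ h₅) v hv)

end Summit.AtomisticToContinuum.BoseEinsteinCondensation.Theorems
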